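import Mathlib
import HarnessLib
import Summits.HubbardSuperconductivity.HubbardSuperconductivity.Theorems.KLProgrammeKLRegimeCountertermJacksonRemainderReadResidueC1Fit
import Summits.HubbardSuperconductivity.HubbardSuperconductivity.Theorems.KLProgrammeKLRegimeSplitFlowPieceOscDefs

/-!
# Route `KLProgramme`, crux K3 — gen-8 ENGINE-FLOW child (stmt-HubbardSuperconductivity-20437 `KLRegimeEngineV17F2`), stub (C)
# `stub_twoLeg_curvature`: «(C1)-OSC-IH» — the (C1) door keyed by the TWO-CONJUNCT induction hypothesis of the v2 text
# (jets `TwoLegReadJetBound cc cc′` AND mean-free value `TwoLegReadOscAt x₀`), the mean-free sup read DIRECTLY instead of from the slope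

Seat hubbard-kl-k3c3-p1 (g10; row «δμ-flow with klAngularMean constant piece»).  The (C1) certificate door (`readResidueC1_jets_of_certFrame`,
p586216) takes the profile's MEAN-FREE SUP `a 0` (`|ν_n(K_n) − klAngularMean ν_n(K_n)| ≤ a 0`) and its jets `a l` (`1 ≤ l ≤ 4`) as separate inputs;
the IH-keyed wrappers of record (`…ReadResidueC1IH/Tables/Fit`) chose `a 0 := (π/2)·bar₁(n)` (mean-free sup FROM THE SLOPE, `…MeanFreeSupSlope`).
At the FIRST flow step (`d = klFlowDeg 0 = 128`, refined record `klC1TableF128r`) the `a 0`-column of the certificate is the dominant one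
(`N₃ = 114.2`, `N₄ = 60030`: the cutoff-defect moments where the degree-128 kernel spills out of the flat tube), which turned the first step into a
SHARP condition on the scale-0 SLOPE: `cc₁(0) ≲ 0.27` (memo C1-HIST-C4 §3/§3d).  Under the v2 text the induction ALSO carries the mean-free VALUE
clause `TwoLegReadOscAt` (private constant `x₀`: `|ν_n(K_n)(θ) − mean| ≤ x₀·U²·4^{−2n}`), so `a 0 := x₀·U²·4^{−2n}` can be read directly — this file.
Effect at the first step [exact arithmetic on `klC1TableF128r`, n = 0 → 1; numerals in the companion «(C1)-OSC-FIT-128r»]: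

  `e₃ = 28.55·x₀ + 0.9262·cc₁ + 0.0924·cc₂ + 0.0134·cc₃ + 0.00142·cc₄`   (slope-keyed: `45.77·cc₁ + …`)
  `e₄ = 3752·x₀ + 27.98·cc₁ + 0.4894·cc₂ + 0.0335·cc₃ + 0.1288·cc₄`     (slope-keyed: `5921·cc₁ + …`)

so the first step closes for `x₀(0) ≲ 0.4` AND `cc₁(0) ≲ 10` (natural sizes: `x₀(0)` a few `10⁻³`, `cc₁(0) ≈ 0.05` — margins ≈ ×100 / ×200) instead of
`cc₁(0) ≲ 0.27` (margin ×5): the sharp scale-0 obligation moves from the SLOPE to the (much smaller) MEAN-FREE SUP, which the (A)/(P) structured value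
estimates of «(P)-OSC» (`…FlowReadResidueOsc`) produce anyway.  Deeper scales are unaffected (`a 0`-columns ≤ `0.02`).

* §1 `ihSizesOsc_of_readJet_readOsc` — the size table `aO l := [l = 0]·x₀·U²·4^{−2n} + [l ≥ 1]·curveJetBar cc cc′ U l n` from the two IH conjuncts;
* §2 **`readResidueC1_jets_of_readJet_readOsc`** (explicit thresholds, abstract frame-size table) and **`…_klEng_of_le`** (stub binders, `n + 1 ≤ 21`):
  `J ∈ C⁴`, value `|J| ≤ bar₁(n)·Td + x₀U²4^{−2n}·N0`, rate rows `T.bound aO k` (`1 ≤ k ≤ 3`), no-rate rows `T.boundNR aO k` (`1 ≤ k ≤ 4`);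
* §3 `ihTableOsc_eq_natural` (`aO = U²·ĉ + U²|U|·ĉ′`, `U`-free tables) and **`readResidueC1_curveJetBar_oscfit`**: the four outputs ⇒
  `∀ k ≤ 4, |∂ᵏJ| ≤ curveJetBar eJO eJO′ U k (n+1)` with explicit tables LINEAR in `(cc, x₀)` / `(cc′)`, un-primed `k = 0` entry ZERO;
* §4 **`readResidueC1_hJ_of_readJet_readOsc(_klEng_of_le)`** — the literal `(hJdiff, hJ)` of `readResidue_flow_hP` from the regime, `FrameOK … K_{n+1}`,
  the certificate, and the two-conjunct IH.

Bookkeeping only; no definition; the certificate Props stay hypotheses; nothing here asserts any stub of 20437, K3 or superconductivity.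
References: BGM 2006 §2.4 (2.36) [cite: BenfattoGiulianiMastropietro2006].
-/

noncomputable section

namespace Summit.HubbardSuperconductivity.HubbardSuperconductivity.Theorems.KLRegimeSplit

set_option linter.dupNamespace false -- summit = problem name (single-conjunct summit), D-0017

open Real
open Literature.MathematicalPhysics.QuantumLattice Literature.Probability.LatticeModels
open Summit.HubbardSuperconductivity.HubbardSuperconductivity.Theorems.PerturbedFermiCurve
open Summit.HubbardSuperconductivity.HubbardSuperconductivity.Theorems.EngineV8

/-! ## §1 The size table from the two IH conjuncts -/

section IH

variable {L M : ℕ} [NeZero L] [NeZero M]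

/-- **The two-conjunct IH's size table for the (C1) certificate**: `aO 0 := x₀·U²·4^{−2n}` (the mean-free value clause, read directly),
`aO l := curveJetBar cc cc′ U l n` (`l ≥ 1`, the jets) — nonnegativity, the mean-free sup, the jets. -/
theorem ihSizesOsc_of_readJet_readOsc {cc cc' : ℕ → ℝ} (hcc : ∀ k, 0 ≤ cc k) (hcc' : ∀ k, 0 ≤ cc' k) {x₀ : ℝ} (hx₀ : 0 ≤ x₀)
    {β U μ : ℝ} {n : ℕ} (hIH : TwoLegReadJetBound L M cc cc' β U μ (klFlowFrameU L M β U μ n) n)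
    (hOsc : TwoLegReadOscAt L M x₀ β U μ (klFlowFrameU L M β U μ n) n) :
    (∀ l, 0 ≤ (fun l : ℕ => if l = 0 then x₀ * U ^ 2 * (4 : ℝ) ^ (-2 * (n : ℤ)) else curveJetBar cc cc' U l n) l) ∧
    (∀ x, |klLocalPart L M β U μ (klFlowFrameU L M β U μ n) n x -
        klAngularMean (fun θ => klLocalPart L M β U μ (klFlowFrameU L M β U μ n) n θ)| ≤
      (fun l : ℕ => if l = 0 then x₀ * U ^ 2 * (4 : ℝ) ^ (-2 * (n : ℤ)) else curveJetBar cc cc' U l n) 0) ∧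
    (∀ l, 1 ≤ l → l ≤ 4 → ∀ x, |iteratedDeriv l (fun x => klLocalPart L M β U μ (klFlowFrameU L M β U μ n) n x) x| ≤
      (fun l : ℕ => if l = 0 then x₀ * U ^ 2 * (4 : ℝ) ^ (-2 * (n : ℤ)) else curveJetBar cc cc' U l n) l) := by
  have hbar : ∀ k, 0 ≤ curveJetBar cc cc' U k n := fun k => curveJetBar_nonneg hcc hcc' U k n
  refine ⟨fun l => ?_, fun x => ?_, fun l hl1 hl4 x => ?_⟩
  · by_cases hl : l = 0
    · simp only [hl, if_true]; exact mul_nonneg (mul_nonneg hx₀ (sq_nonneg U)) (zpow_nonneg (by norm_num) _)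
    · simp only [hl, if_false]; exact hbar l
  · simp only [if_true]
    exact hOsc x
  · have hl : l ≠ 0 := by omega
    simp only [hl, if_false]
    exact hIH.le hl4 x

/-! ## §2 The (C1) door keyed by the two-conjunct IH -/

/-- **THE (C1) DOOR KEYED BY (jets, mean-free value)** (explicit thresholds `klCurveC3/klCurveU0`; abstract frame-size table `A`): from the regime,
`FrameOK … K_{n+1}`, the certificate `CutoffDefectCertFrame (klFlowDeg n) A T`, frame sizes `≤ A`, the jets IH `TwoLegReadJetBound L M cc cc' β U μ K_n n`
(`cc, cc' ≥ 0`) and the value IH `TwoLegReadOscAt L M x₀ β U μ K_n n` (`x₀ ≥ 0`): `J ∈ C⁴`, the value row `|J| ≤ bar₁(n)·Td + x₀U²4^{−2n}·N0`, the rate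
rows (`1 ≤ k ≤ 3`) and the no-rate rows (`1 ≤ k ≤ 4`) of the certificate on the table `aO`. -/
theorem readResidueC1_jets_of_readJet_readOsc {R : RenConsts} (hR : ∀ j, 0 ≤ R.Gfr j) {c : ℝ} (hc : 0 < c) (hcle : c ≤ klCurveC3 R)
    {U : ℝ} (hU : 0 < U) (hUle : U ≤ klCurveU0 R) {β : ℝ} (hβmin : klBetaMin ≤ β) (hβc : β ≤ Real.exp (c / U ^ 2))
    {μ : ℝ} (hμ : μ ∈ klWindowC) {n : ℕ} (hK : FrameOK R U (nScales β) μ (klFlowFrameU L M β U μ (n + 1)))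
    {d : ℕ} (hd : klFlowDeg n = d) {A : ℕ → ℝ} {T : CutoffDefectTable} (hcert : CutoffDefectCertFrame d A T)
    (hA : ∀ j ≤ 4, ∀ p : EuclideanSpace ℝ (Fin 2),
      ‖iteratedFDeriv ℝ j (fun q : EuclideanSpace ℝ (Fin 2) => (klFlowFrameU L M β U μ (n + 1)).eval (WithLp.ofLp q)) p‖ ≤ A j)
    {cc cc' : ℕ → ℝ} (hcc : ∀ k, 0 ≤ cc k) (hcc' : ∀ k, 0 ≤ cc' k) {x₀ : ℝ} (hx₀ : 0 ≤ x₀)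
    (hIH : TwoLegReadJetBound L M cc cc' β U μ (klFlowFrameU L M β U μ n) n)
    (hOsc : TwoLegReadOscAt L M x₀ β U μ (klFlowFrameU L M β U μ n) n) :
    ContDiff ℝ 4 (fun θ : ℝ => klLocalPart L M β U μ (klFlowFrameU L M β U μ n) n θ -
        (klFlowPiece L M β U μ n).eval (klFermiPoint μ (klFlowFrameU L M β U μ (n + 1)) θ)) ∧
    (∀ θ : ℝ, |klLocalPart L M β U μ (klFlowFrameU L M β U μ n) n θ -
        (klFlowPiece L M β U μ n).eval (klFermiPoint μ (klFlowFrameU L M β U μ (n + 1)) θ)| ≤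
      curveJetBar cc cc' U 1 n * T.Td + x₀ * U ^ 2 * (4 : ℝ) ^ (-2 * (n : ℤ)) * T.N0) ∧
    (∀ k, 1 ≤ k → k ≤ 3 → ∀ θ : ℝ, |iteratedDeriv k (fun θ : ℝ => klLocalPart L M β U μ (klFlowFrameU L M β U μ n) n θ -
        (klFlowPiece L M β U μ n).eval (klFermiPoint μ (klFlowFrameU L M β U μ (n + 1)) θ)) θ| ≤
      T.bound (fun l : ℕ => if l = 0 then x₀ * U ^ 2 * (4 : ℝ) ^ (-2 * (n : ℤ)) else curveJetBar cc cc' U l n) k) ∧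
    (∀ k, 1 ≤ k → k ≤ 4 → ∀ θ : ℝ, |iteratedDeriv k (fun θ : ℝ => klLocalPart L M β U μ (klFlowFrameU L M β U μ n) n θ -
        (klFlowPiece L M β U μ n).eval (klFermiPoint μ (klFlowFrameU L M β U μ (n + 1)) θ)) θ| ≤
      T.boundNR (fun l : ℕ => if l = 0 then x₀ * U ^ 2 * (4 : ℝ) ^ (-2 * (n : ℤ)) else curveJetBar cc cc' U l n) k) := by
  obtain ⟨ha_nn, ha0, ha⟩ := ihSizesOsc_of_readJet_readOsc (L := L) (M := M) hcc hcc' hx₀ hIH hOsc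
  obtain ⟨h1, h2, h3, h4⟩ := readResidueC1_jets_of_certFrame hR hc hcle hU hUle hβmin hβc hμ hK hd hcert hA hIH.contDiff ha_nn ha0 ha
  refine ⟨h1, fun θ => ?_, h3, h4⟩
  have h := h2 θ
  simp only [if_true, one_ne_zero, if_false] at h
  exact h

/-- **THE SAME AT STUB (C)'s BINDERS** (`R.WF`, `c ≤ klEngC₃6 P R`, `U ≤ klEngU₀9 P R c`, `n + 1 ≤ 21`, history `FlowPieceJetsAt … m` for `m ≤ n`,
any certificate size table `A ≥ 10⁻¹²` — all records). -/
theorem readResidueC1_jets_of_readJet_readOsc_klEng_of_le {P : SplitConsts} {R : RenConsts} (hRW : R.WF) {c : ℝ} (hc : 0 < c)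
    (hc6 : c ≤ klEngC₃6 P R) {μ : ℝ} (hμ : μ ∈ klWindowC) {U : ℝ} (hU : 0 < U) (hU9 : U ≤ klEngU₀9 P R c) {β : ℝ}
    (hβmin : klBetaMin ≤ β) (hβc : β ≤ Real.exp (c / U ^ 2)) {n : ℕ} (hn : n + 1 ≤ 21)
    (hK : FrameOK R U (nScales β) μ (klFlowFrameU L M β U μ (n + 1))) (hist : ∀ m < n + 1, FlowPieceJetsAt L M β U μ R m)
    {d : ℕ} (hd : klFlowDeg n = d) {A : ℕ → ℝ} {T : CutoffDefectTable} (hcert : CutoffDefectCertFrame d A T)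
    (hA12 : ∀ j ≤ 4, (1 : ℝ) / 10 ^ 12 ≤ A j)
    {cc cc' : ℕ → ℝ} (hcc : ∀ k, 0 ≤ cc k) (hcc' : ∀ k, 0 ≤ cc' k) {x₀ : ℝ} (hx₀ : 0 ≤ x₀)
    (hIH : TwoLegReadJetBound L M cc cc' β U μ (klFlowFrameU L M β U μ n) n)
    (hOsc : TwoLegReadOscAt L M x₀ β U μ (klFlowFrameU L M β U μ n) n) :
    ContDiff ℝ 4 (fun θ : ℝ => klLocalPart L M β U μ (klFlowFrameU L M β U μ n) n θ -
        (klFlowPiece L M β U μ n).eval (klFermiPoint μ (klFlowFrameU L M β U μ (n + 1)) θ)) ∧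
    (∀ θ : ℝ, |klLocalPart L M β U μ (klFlowFrameU L M β U μ n) n θ -
        (klFlowPiece L M β U μ n).eval (klFermiPoint μ (klFlowFrameU L M β U μ (n + 1)) θ)| ≤
      curveJetBar cc cc' U 1 n * T.Td + x₀ * U ^ 2 * (4 : ℝ) ^ (-2 * (n : ℤ)) * T.N0) ∧
    (∀ k, 1 ≤ k → k ≤ 3 → ∀ θ : ℝ, |iteratedDeriv k (fun θ : ℝ => klLocalPart L M β U μ (klFlowFrameU L M β U μ n) n θ -
        (klFlowPiece L M β U μ n).eval (klFermiPoint μ (klFlowFrameU L M β U μ (n + 1)) θ)) θ| ≤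
      T.bound (fun l : ℕ => if l = 0 then x₀ * U ^ 2 * (4 : ℝ) ^ (-2 * (n : ℤ)) else curveJetBar cc cc' U l n) k) ∧
    (∀ k, 1 ≤ k → k ≤ 4 → ∀ θ : ℝ, |iteratedDeriv k (fun θ : ℝ => klLocalPart L M β U μ (klFlowFrameU L M β U μ n) n θ -
        (klFlowPiece L M β U μ n).eval (klFermiPoint μ (klFlowFrameU L M β U μ (n + 1)) θ)) θ| ≤
      T.boundNR (fun l : ℕ => if l = 0 then x₀ * U ^ 2 * (4 : ℝ) ^ (-2 * (n : ℤ)) else curveJetBar cc cc' U l n) k) := by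
  have hR : ∀ j, 0 ≤ R.Gfr j := hRW.2.2
  have hcle : c ≤ klCurveC3 R := hc6.trans ((klEngC₃6_le_klEngC₃3 P R).trans (klEngC₃3_le_klCurveC3 P hR))
  have hUle : U ≤ klCurveU0 R := hU9.trans ((klEngU₀9_le_klEngU₀3 P R c).trans (klEngU₀3_le_klCurveU0 P hR c))
  have hA := flowFrame_sizes_le_table_of_klEngU₀9_of_le (L := L) (M := M) (β := β) (μ := μ) hRW hU hU9 hn hist hA12
  exact readResidueC1_jets_of_readJet_readOsc hR hc hcle hU hUle hβmin hβc hμ hK hd hcert hA hcc hcc' hx₀ hIH hOsc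

end IH

/-! ## §3 The natural tables and the fit -/

/-- **`aO = U²·ĉ + U²|U|·ĉ′`** with the `U`-free tables `ĉ l := [l = 0]·x₀·4^{−2n} + [l ≥ 1]·cc l·4^{(l−2)n}`, `ĉ′ l := [l ≥ 1]·cc′ l·4^{(l−2)n}`. -/
theorem ihTableOsc_eq_natural (cc cc' : ℕ → ℝ) (x₀ U : ℝ) (n : ℕ) :
    (fun l : ℕ => if l = 0 then x₀ * U ^ 2 * (4 : ℝ) ^ (-2 * (n : ℤ)) else curveJetBar cc cc' U l n) =
      fun l : ℕ => U ^ 2 * (if l = 0 then x₀ * (4 : ℝ) ^ (-2 * (n : ℤ)) else cc l * (4 : ℝ) ^ (((l : ℤ) - 2) * n)) +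
        U ^ 2 * |U| * (if l = 0 then 0 else cc' l * (4 : ℝ) ^ (((l : ℤ) - 2) * n)) := by
  funext l
  by_cases hl : l = 0
  · simp only [hl, if_true]
    ring
  · simp only [hl, if_false, curveJetBar, uPow]
    ring

section Fit

variable {L M : ℕ} [NeZero L] [NeZero M]

/-- **THE (C1) FIT ON THE TWO-CONJUNCT IH.**  From the four outputs of `readResidueC1_jets_of_readJet_readOsc` (value row, rate rows `1 ≤ k ≤ 3`, no-rate rows
`1 ≤ k ≤ 4`), `|U| ≤ 1`, `cc′ 1, T.Td, T.N0 ≥ 0`: `|∂ᵏJ| ≤ curveJetBar eJO eJO′ U k (n+1)` for every `k ≤ 4`, with the explicit tables of the statement —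
rate form at `k ≤ 3`, no-rate at `k = 4`, the value row entirely in the primed column (`eJO 0 = 0`). -/
theorem readResidueC1_curveJetBar_oscfit {J : ℝ → ℝ} {T : CutoffDefectTable} {cc cc' : ℕ → ℝ} {x₀ U : ℝ} {n : ℕ} (hU1 : |U| ≤ 1)
    (hcc'1 : 0 ≤ cc' 1) (hTd : 0 ≤ T.Td)
    (h2 : ∀ θ : ℝ, |J θ| ≤ curveJetBar cc cc' U 1 n * T.Td + x₀ * U ^ 2 * (4 : ℝ) ^ (-2 * (n : ℤ)) * T.N0)
    (h3 : ∀ k, 1 ≤ k → k ≤ 3 → ∀ θ : ℝ, |iteratedDeriv k J θ| ≤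
      T.bound (fun l : ℕ => if l = 0 then x₀ * U ^ 2 * (4 : ℝ) ^ (-2 * (n : ℤ)) else curveJetBar cc cc' U l n) k)
    (h4 : ∀ k, 1 ≤ k → k ≤ 4 → ∀ θ : ℝ, |iteratedDeriv k J θ| ≤
      T.boundNR (fun l : ℕ => if l = 0 then x₀ * U ^ 2 * (4 : ℝ) ^ (-2 * (n : ℤ)) else curveJetBar cc cc' U l n) k) :
    ∀ k ≤ 4, ∀ θ : ℝ, |iteratedDeriv k J θ| ≤
      curveJetBar
        (fun k => if k = 0 then 0 else
          (if k ≤ 3 then T.bound (fun l : ℕ => if l = 0 then x₀ * (4 : ℝ) ^ (-2 * (n : ℤ)) else cc l * (4 : ℝ) ^ (((l : ℤ) - 2) * n)) k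
            else T.boundNR (fun l : ℕ => if l = 0 then x₀ * (4 : ℝ) ^ (-2 * (n : ℤ)) else cc l * (4 : ℝ) ^ (((l : ℤ) - 2) * n)) k) *
            ((4 : ℝ) ^ (((k : ℤ) - 2) * ((n + 1 : ℕ) : ℤ)))⁻¹)
        (fun k => if k = 0 then ((cc 1 + cc' 1) * T.Td * (4 : ℝ) ^ ((((1 : ℕ) : ℤ) - 2) * n) + x₀ * T.N0 * (4 : ℝ) ^ (-2 * (n : ℤ))) *
            ((4 : ℝ) ^ ((((0 : ℕ) : ℤ) - 2) * ((n + 1 : ℕ) : ℤ)))⁻¹ else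
          (if k ≤ 3 then T.bound (fun l : ℕ => if l = 0 then 0 else cc' l * (4 : ℝ) ^ (((l : ℤ) - 2) * n)) k
            else T.boundNR (fun l : ℕ => if l = 0 then 0 else cc' l * (4 : ℝ) ^ (((l : ℤ) - 2) * n)) k) *
            ((4 : ℝ) ^ (((k : ℤ) - 2) * ((n + 1 : ℕ) : ℤ)))⁻¹)
        U k (n + 1) := by
  set ĉ : ℕ → ℝ := fun l => if l = 0 then x₀ * (4 : ℝ) ^ (-2 * (n : ℤ)) else cc l * (4 : ℝ) ^ (((l : ℤ) - 2) * n) with hĉ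
  set ĉ' : ℕ → ℝ := fun l => if l = 0 then 0 else cc' l * (4 : ℝ) ^ (((l : ℤ) - 2) * n) with hĉ'
  have hâ : (fun l : ℕ => if l = 0 then x₀ * U ^ 2 * (4 : ℝ) ^ (-2 * (n : ℤ)) else curveJetBar cc cc' U l n) =
      fun l => U ^ 2 * ĉ l + U ^ 2 * |U| * ĉ' l := ihTableOsc_eq_natural cc cc' x₀ U n
  intro k hk θ
  by_cases hk0 : k = 0
  · -- value row, booked in the primed column
    subst hk0
    rw [iteratedDeriv_zero]
    refine (h2 θ).trans ?_
    have hz : (4 : ℝ) ^ ((((0 : ℕ) : ℤ) - 2) * ((n + 1 : ℕ) : ℤ)) ≠ 0 := zpow_ne_zero _ (by norm_num)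
    have hp : 0 ≤ (4 : ℝ) ^ ((((1 : ℕ) : ℤ) - 2) * n) := zpow_nonneg (by norm_num) _
    have hUU : U ^ 2 = |U| * |U| := by rw [← sq_abs, sq]
    have htarget : curveJetBar
        (fun k => if k = 0 then 0 else
          (if k ≤ 3 then T.bound ĉ k else T.boundNR ĉ k) * ((4 : ℝ) ^ (((k : ℤ) - 2) * ((n + 1 : ℕ) : ℤ)))⁻¹)
        (fun k => if k = 0 then ((cc 1 + cc' 1) * T.Td * (4 : ℝ) ^ ((((1 : ℕ) : ℤ) - 2) * n) + x₀ * T.N0 * (4 : ℝ) ^ (-2 * (n : ℤ))) *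
            ((4 : ℝ) ^ ((((0 : ℕ) : ℤ) - 2) * ((n + 1 : ℕ) : ℤ)))⁻¹ else
          (if k ≤ 3 then T.bound ĉ' k else T.boundNR ĉ' k) * ((4 : ℝ) ^ (((k : ℤ) - 2) * ((n + 1 : ℕ) : ℤ)))⁻¹) U 0 (n + 1) =
        ((cc 1 + cc' 1) * T.Td * (4 : ℝ) ^ ((((1 : ℕ) : ℤ) - 2) * n) + x₀ * T.N0 * (4 : ℝ) ^ (-2 * (n : ℤ))) * U ^ 2 := by
      rw [curveJetBar_apply, hUU]
      simp only [if_true, uPow_zero, zero_add]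
      field_simp
    rw [htarget]
    have hle : cc 1 + cc' 1 * |U| ≤ cc 1 + cc' 1 := by nlinarith [abs_nonneg U]
    have hU2 : 0 ≤ U ^ 2 := sq_nonneg U
    calc curveJetBar cc cc' U 1 n * T.Td + x₀ * U ^ 2 * (4 : ℝ) ^ (-2 * (n : ℤ)) * T.N0
        = (cc 1 + cc' 1 * |U|) * (U ^ 2 * (4 : ℝ) ^ ((((1 : ℕ) : ℤ) - 2) * n) * T.Td) + x₀ * U ^ 2 * (4 : ℝ) ^ (-2 * (n : ℤ)) * T.N0 := by
          simp only [curveJetBar, uPow, one_ne_zero, if_false]; ring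
      _ ≤ (cc 1 + cc' 1) * (U ^ 2 * (4 : ℝ) ^ ((((1 : ℕ) : ℤ) - 2) * n) * T.Td) + x₀ * U ^ 2 * (4 : ℝ) ^ (-2 * (n : ℤ)) * T.N0 :=
          add_le_add (mul_le_mul_of_nonneg_right hle (mul_nonneg (mul_nonneg hU2 hp) hTd)) le_rfl
      _ = ((cc 1 + cc' 1) * T.Td * (4 : ℝ) ^ ((((1 : ℕ) : ℤ) - 2) * n) + x₀ * T.N0 * (4 : ℝ) ^ (-2 * (n : ℤ))) * U ^ 2 := by ring
  · have hk1 : 1 ≤ k := Nat.one_le_iff_ne_zero.mpr hk0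
    by_cases hk3 : k ≤ 3
    · have h := h3 k hk1 hk3 θ
      rw [hâ, T.bound_lin] at h
      refine h.trans (le_of_eq ?_)
      rw [← curveJetBar_rescale hk0 (T.bound ĉ k) (T.bound ĉ' k) U n]
      exact curveJetBar_congr_at (by simp [hk0, hk3]) (by simp [hk0, hk3])
    · have hk4 : k = 4 := by omega
      have h := h4 k hk1 (by omega) θ
      rw [hâ, T.boundNR_lin] at h
      refine h.trans (le_of_eq ?_)
      rw [← curveJetBar_rescale hk0 (T.boundNR ĉ k) (T.boundNR ĉ' k) U n]
      exact curveJetBar_congr_at (by simp [hk0, hk3]) (by simp [hk0, hk3])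

end Fit

/-! ## §4 The `(hJdiff, hJ)` pair of `readResidue_flow_hP` from the two-conjunct IH, one call -/

section Door

variable {L M : ℕ} [NeZero L] [NeZero M]

/-- **THE (C1) DOOR IN `readResidue_flow_hP`'S CURRENCY FROM THE TWO-CONJUNCT IH** (explicit thresholds, abstract frame-size table `A`; `T.Td ≥ 0`). -/
theorem readResidueC1_hJ_of_readJet_readOsc {R : RenConsts} (hR : ∀ j, 0 ≤ R.Gfr j) {c : ℝ} (hc : 0 < c) (hcle : c ≤ klCurveC3 R)
    {U : ℝ} (hU : 0 < U) (hUle : U ≤ klCurveU0 R) {β : ℝ} (hβmin : klBetaMin ≤ β) (hβc : β ≤ Real.exp (c / U ^ 2))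
    {μ : ℝ} (hμ : μ ∈ klWindowC) {n : ℕ} (hK : FrameOK R U (nScales β) μ (klFlowFrameU L M β U μ (n + 1)))
    {d : ℕ} (hd : klFlowDeg n = d) {A : ℕ → ℝ} {T : CutoffDefectTable} (hcert : CutoffDefectCertFrame d A T) (hTd : 0 ≤ T.Td)
    (hA : ∀ j ≤ 4, ∀ p : EuclideanSpace ℝ (Fin 2),
      ‖iteratedFDeriv ℝ j (fun q : EuclideanSpace ℝ (Fin 2) => (klFlowFrameU L M β U μ (n + 1)).eval (WithLp.ofLp q)) p‖ ≤ A j)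
    {cc cc' : ℕ → ℝ} (hcc : ∀ k, 0 ≤ cc k) (hcc' : ∀ k, 0 ≤ cc' k) {x₀ : ℝ} (hx₀ : 0 ≤ x₀)
    (hIH : TwoLegReadJetBound L M cc cc' β U μ (klFlowFrameU L M β U μ n) n)
    (hOsc : TwoLegReadOscAt L M x₀ β U μ (klFlowFrameU L M β U μ n) n) :
    ContDiff ℝ 4 (fun θ : ℝ => klLocalPart L M β U μ (klFlowFrameU L M β U μ n) n θ -
        (klFlowPiece L M β U μ n).eval (klFermiPoint μ (klFlowFrameU L M β U μ (n + 1)) θ)) ∧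
    ∀ k ≤ 4, ∀ θ : ℝ, |iteratedDeriv k (fun θ : ℝ => klLocalPart L M β U μ (klFlowFrameU L M β U μ n) n θ -
        (klFlowPiece L M β U μ n).eval (klFermiPoint μ (klFlowFrameU L M β U μ (n + 1)) θ)) θ| ≤
      curveJetBar
        (fun k => if k = 0 then 0 else
          (if k ≤ 3 then T.bound (fun l : ℕ => if l = 0 then x₀ * (4 : ℝ) ^ (-2 * (n : ℤ)) else cc l * (4 : ℝ) ^ (((l : ℤ) - 2) * n)) k
            else T.boundNR (fun l : ℕ => if l = 0 then x₀ * (4 : ℝ) ^ (-2 * (n : ℤ)) else cc l * (4 : ℝ) ^ (((l : ℤ) - 2) * n)) k) *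
            ((4 : ℝ) ^ (((k : ℤ) - 2) * ((n + 1 : ℕ) : ℤ)))⁻¹)
        (fun k => if k = 0 then ((cc 1 + cc' 1) * T.Td * (4 : ℝ) ^ ((((1 : ℕ) : ℤ) - 2) * n) + x₀ * T.N0 * (4 : ℝ) ^ (-2 * (n : ℤ))) *
            ((4 : ℝ) ^ ((((0 : ℕ) : ℤ) - 2) * ((n + 1 : ℕ) : ℤ)))⁻¹ else
          (if k ≤ 3 then T.bound (fun l : ℕ => if l = 0 then 0 else cc' l * (4 : ℝ) ^ (((l : ℤ) - 2) * n)) k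
            else T.boundNR (fun l : ℕ => if l = 0 then 0 else cc' l * (4 : ℝ) ^ (((l : ℤ) - 2) * n)) k) *
            ((4 : ℝ) ^ (((k : ℤ) - 2) * ((n + 1 : ℕ) : ℤ)))⁻¹)
        U k (n + 1) := by
  obtain ⟨h1, h2, h3, h4⟩ :=
    readResidueC1_jets_of_readJet_readOsc hR hc hcle hU hUle hβmin hβc hμ hK hd hcert hA hcc hcc' hx₀ hIH hOsc
  have hU1 : |U| ≤ 1 := by rw [abs_of_pos hU]; exact hUle.trans (klCurveU0_le_one R)
  exact ⟨h1, readResidueC1_curveJetBar_oscfit hU1 (hcc' 1) hTd h2 h3 h4⟩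

/-- **THE SAME AT STUB (C)'s BINDERS** (`R.WF`, `c ≤ klEngC₃6 P R`, `U ≤ klEngU₀9 P R c`, `n + 1 ≤ 21`, history `FlowPieceJetsAt … m` for `m ≤ n`,
any certificate size table `A ≥ 10⁻¹²`). -/
theorem readResidueC1_hJ_of_readJet_readOsc_klEng_of_le {P : SplitConsts} {R : RenConsts} (hRW : R.WF) {c : ℝ} (hc : 0 < c)
    (hc6 : c ≤ klEngC₃6 P R) {μ : ℝ} (hμ : μ ∈ klWindowC) {U : ℝ} (hU : 0 < U) (hU9 : U ≤ klEngU₀9 P R c) {β : ℝ}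
    (hβmin : klBetaMin ≤ β) (hβc : β ≤ Real.exp (c / U ^ 2)) {n : ℕ} (hn : n + 1 ≤ 21)
    (hK : FrameOK R U (nScales β) μ (klFlowFrameU L M β U μ (n + 1))) (hist : ∀ m < n + 1, FlowPieceJetsAt L M β U μ R m)
    {d : ℕ} (hd : klFlowDeg n = d) {A : ℕ → ℝ} {T : CutoffDefectTable} (hcert : CutoffDefectCertFrame d A T) (hTd : 0 ≤ T.Td)
    (hA12 : ∀ j ≤ 4, (1 : ℝ) / 10 ^ 12 ≤ A j)
    {cc cc' : ℕ → ℝ} (hcc : ∀ k, 0 ≤ cc k) (hcc' : ∀ k, 0 ≤ cc' k) {x₀ : ℝ} (hx₀ : 0 ≤ x₀)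
    (hIH : TwoLegReadJetBound L M cc cc' β U μ (klFlowFrameU L M β U μ n) n)
    (hOsc : TwoLegReadOscAt L M x₀ β U μ (klFlowFrameU L M β U μ n) n) :
    ContDiff ℝ 4 (fun θ : ℝ => klLocalPart L M β U μ (klFlowFrameU L M β U μ n) n θ -
        (klFlowPiece L M β U μ n).eval (klFermiPoint μ (klFlowFrameU L M β U μ (n + 1)) θ)) ∧
    ∀ k ≤ 4, ∀ θ : ℝ, |iteratedDeriv k (fun θ : ℝ => klLocalPart L M β U μ (klFlowFrameU L M β U μ n) n θ -
        (klFlowPiece L M β U μ n).eval (klFermiPoint μ (klFlowFrameU L M β U μ (n + 1)) θ)) θ| ≤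
      curveJetBar
        (fun k => if k = 0 then 0 else
          (if k ≤ 3 then T.bound (fun l : ℕ => if l = 0 then x₀ * (4 : ℝ) ^ (-2 * (n : ℤ)) else cc l * (4 : ℝ) ^ (((l : ℤ) - 2) * n)) k
            else T.boundNR (fun l : ℕ => if l = 0 then x₀ * (4 : ℝ) ^ (-2 * (n : ℤ)) else cc l * (4 : ℝ) ^ (((l : ℤ) - 2) * n)) k) *
            ((4 : ℝ) ^ (((k : ℤ) - 2) * ((n + 1 : ℕ) : ℤ)))⁻¹)
        (fun k => if k = 0 then ((cc 1 + cc' 1) * T.Td * (4 : ℝ) ^ ((((1 : ℕ) : ℤ) - 2) * n) + x₀ * T.N0 * (4 : ℝ) ^ (-2 * (n : ℤ))) *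
            ((4 : ℝ) ^ ((((0 : ℕ) : ℤ) - 2) * ((n + 1 : ℕ) : ℤ)))⁻¹ else
          (if k ≤ 3 then T.bound (fun l : ℕ => if l = 0 then 0 else cc' l * (4 : ℝ) ^ (((l : ℤ) - 2) * n)) k
            else T.boundNR (fun l : ℕ => if l = 0 then 0 else cc' l * (4 : ℝ) ^ (((l : ℤ) - 2) * n)) k) *
            ((4 : ℝ) ^ (((k : ℤ) - 2) * ((n + 1 : ℕ) : ℤ)))⁻¹)
        U k (n + 1) := by
  have hR : ∀ j, 0 ≤ R.Gfr j := hRW.2.2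
  have hcle : c ≤ klCurveC3 R := hc6.trans ((klEngC₃6_le_klEngC₃3 P R).trans (klEngC₃3_le_klCurveC3 P hR))
  have hUle : U ≤ klCurveU0 R := hU9.trans ((klEngU₀9_le_klEngU₀3 P R c).trans (klEngU₀3_le_klCurveU0 P hR c))
  have hA := flowFrame_sizes_le_table_of_klEngU₀9_of_le (L := L) (M := M) (β := β) (μ := μ) hRW hU hU9 hn hist hA12
  exact readResidueC1_hJ_of_readJet_readOsc hR hc hcle hU hUle hβmin hβc hμ hK hd hcert hTd hA hcc hcc' hx₀ hIH hOsc

end Door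

/-! ## §5 (append, g10) The (C1) value row of the two-conjunct door in the mean-free clause's currency -/

section OscRow

variable {L M : ℕ} [NeZero L] [NeZero M]

omit [NeZero L] [NeZero M] in
/-- Rescaling: `bar₁(n)·Td + x₀·U²·4^{−2n}·N0 = [16·4ⁿ·Td·(cc₁ + cc′₁|U|) + 16·N0·x₀]·U²·4^{−2(n+1)}` (slope law at `n` and value law at `n` → value law at
`n+1`; both brackets are `n`-uniform along `d_n = klFlowDeg n`). -/
theorem oscRow_rescale (cc cc' : ℕ → ℝ) (x₀ U Td N0 : ℝ) (n : ℕ) :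
    curveJetBar cc cc' U 1 n * Td + x₀ * U ^ 2 * (4 : ℝ) ^ (-2 * (n : ℤ)) * N0 =
      (16 * (4 : ℝ) ^ n * Td * (cc 1 + cc' 1 * |U|) + 16 * N0 * x₀) * U ^ 2 * (4 : ℝ) ^ (-2 * ((n + 1 : ℕ) : ℤ)) := by
  have h1 : (4 : ℝ) ^ ((((1 : ℕ) : ℤ) - 2) * (n : ℤ)) = ((4 : ℝ) ^ n)⁻¹ := by
    rw [show (((1 : ℕ) : ℤ) - 2) * (n : ℤ) = -(n : ℤ) by push_cast; ring, zpow_neg, zpow_natCast]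
  have h2 : (4 : ℝ) ^ (-2 * ((n + 1 : ℕ) : ℤ)) = ((4 : ℝ) ^ (n + 1) * (4 : ℝ) ^ (n + 1))⁻¹ := by
    rw [show -2 * ((n + 1 : ℕ) : ℤ) = -(((n + 1) + (n + 1) : ℕ) : ℤ) by push_cast; ring, zpow_neg, zpow_natCast, pow_add]
  have h3 : (4 : ℝ) ^ (-2 * (n : ℤ)) = ((4 : ℝ) ^ n * (4 : ℝ) ^ n)⁻¹ := by
    rw [show -2 * (n : ℤ) = -((n + n : ℕ) : ℤ) by push_cast; ring, zpow_neg, zpow_natCast, pow_add]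
  rw [curveJetBar_apply, h1, h2, h3]
  simp only [uPow, one_ne_zero, if_false]
  have h4 : (4 : ℝ) ^ n ≠ 0 := pow_ne_zero _ (by norm_num)
  field_simp
  ring

/-- **THE (C1) VALUE ROW IN THE CLAUSE's CURRENCY FROM THE TWO-CONJUNCT IH** (explicit thresholds): the `hJ` input of
`twoLegReadOscAt_flow_succ_of_doors_klReadOscC` (…FlowReadResidueOsc) with `j := 16·4ⁿ·T.Td·(cc₁ + cc′₁|U|) + 16·T.N0·x₀` — the private mean-free
constant's own recursion reads `x₀` through `16·N0(d_n)` only (`0.585` at d = 128, `0.0049` at 512, `1.3·10⁻⁴` at 2048). -/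
theorem readResidueC1_osc_of_readJet_readOsc {R : RenConsts} (hR : ∀ j, 0 ≤ R.Gfr j) {c : ℝ} (hc : 0 < c) (hcle : c ≤ klCurveC3 R)
    {U : ℝ} (hU : 0 < U) (hUle : U ≤ klCurveU0 R) {β : ℝ} (hβmin : klBetaMin ≤ β) (hβc : β ≤ Real.exp (c / U ^ 2))
    {μ : ℝ} (hμ : μ ∈ klWindowC) {n : ℕ} (hK : FrameOK R U (nScales β) μ (klFlowFrameU L M β U μ (n + 1)))
    {d : ℕ} (hd : klFlowDeg n = d) {A : ℕ → ℝ} {T : CutoffDefectTable} (hcert : CutoffDefectCertFrame d A T)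
    (hA : ∀ j ≤ 4, ∀ p : EuclideanSpace ℝ (Fin 2),
      ‖iteratedFDeriv ℝ j (fun q : EuclideanSpace ℝ (Fin 2) => (klFlowFrameU L M β U μ (n + 1)).eval (WithLp.ofLp q)) p‖ ≤ A j)
    {cc cc' : ℕ → ℝ} (hcc : ∀ k, 0 ≤ cc k) (hcc' : ∀ k, 0 ≤ cc' k) {x₀ : ℝ} (hx₀ : 0 ≤ x₀)
    (hIH : TwoLegReadJetBound L M cc cc' β U μ (klFlowFrameU L M β U μ n) n)
    (hOsc : TwoLegReadOscAt L M x₀ β U μ (klFlowFrameU L M β U μ n) n) (θ : ℝ) :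
    |klLocalPart L M β U μ (klFlowFrameU L M β U μ n) n θ -
        (klFlowPiece L M β U μ n).eval (klFermiPoint μ (klFlowFrameU L M β U μ (n + 1)) θ)| ≤
      (16 * (4 : ℝ) ^ n * T.Td * (cc 1 + cc' 1 * |U|) + 16 * T.N0 * x₀) * U ^ 2 * (4 : ℝ) ^ (-2 * ((n + 1 : ℕ) : ℤ)) := by
  have h := (readResidueC1_jets_of_readJet_readOsc hR hc hcle hU hUle hβmin hβc hμ hK hd hcert hA hcc hcc' hx₀ hIH hOsc).2.1 θ
  rwa [oscRow_rescale] at h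

/-- **THE SAME AT STUB (C)'s BINDERS** (`R.WF`, `c ≤ klEngC₃6 P R`, `U ≤ klEngU₀9 P R c`, `n + 1 ≤ 21`, history, any certificate size table `A ≥ 10⁻¹²`). -/
theorem readResidueC1_osc_of_readJet_readOsc_klEng_of_le {P : SplitConsts} {R : RenConsts} (hRW : R.WF) {c : ℝ} (hc : 0 < c)
    (hc6 : c ≤ klEngC₃6 P R) {μ : ℝ} (hμ : μ ∈ klWindowC) {U : ℝ} (hU : 0 < U) (hU9 : U ≤ klEngU₀9 P R c) {β : ℝ}
    (hβmin : klBetaMin ≤ β) (hβc : β ≤ Real.exp (c / U ^ 2)) {n : ℕ} (hn : n + 1 ≤ 21)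
    (hK : FrameOK R U (nScales β) μ (klFlowFrameU L M β U μ (n + 1))) (hist : ∀ m < n + 1, FlowPieceJetsAt L M β U μ R m)
    {d : ℕ} (hd : klFlowDeg n = d) {A : ℕ → ℝ} {T : CutoffDefectTable} (hcert : CutoffDefectCertFrame d A T)
    (hA12 : ∀ j ≤ 4, (1 : ℝ) / 10 ^ 12 ≤ A j)
    {cc cc' : ℕ → ℝ} (hcc : ∀ k, 0 ≤ cc k) (hcc' : ∀ k, 0 ≤ cc' k) {x₀ : ℝ} (hx₀ : 0 ≤ x₀)
    (hIH : TwoLegReadJetBound L M cc cc' β U μ (klFlowFrameU L M β U μ n) n)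
    (hOsc : TwoLegReadOscAt L M x₀ β U μ (klFlowFrameU L M β U μ n) n) (θ : ℝ) :
    |klLocalPart L M β U μ (klFlowFrameU L M β U μ n) n θ -
        (klFlowPiece L M β U μ n).eval (klFermiPoint μ (klFlowFrameU L M β U μ (n + 1)) θ)| ≤
      (16 * (4 : ℝ) ^ n * T.Td * (cc 1 + cc' 1 * |U|) + 16 * T.N0 * x₀) * U ^ 2 * (4 : ℝ) ^ (-2 * ((n + 1 : ℕ) : ℤ)) := by
  have h := (readResidueC1_jets_of_readJet_readOsc_klEng_of_le hRW hc hc6 hμ hU hU9 hβmin hβc hn hK hist hd hcert hA12 hcc hcc' hx₀ hIH hOsc).2.1 θ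
  rwa [oscRow_rescale] at h

end OscRow

end Summit.HubbardSuperconductivity.HubbardSuperconductivity.Theorems.KLRegimeSplit

end
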